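import Summits.AtomisticToContinuum.Crystallization.Theorems.GappedShellCensusCleanLimitsHaveWindowsVerticalPinning3

/-!
# Vertical pinning, part 4: the certified gain of expanding a LOW gap

Helper for the registered stub `stub_verticalPinning` (T4b-iv) of line `Sketch` of the crux
`GappedShellCensus.CleanLimitsHaveWindows` (stmt-AtomisticToContinuum-15932).

In-plane spacing `b ≤ 99/100` (and `b ≥ 47/50`), so `53/50 ≤ b⁻⁶`. A LOW gap (`Δ_g ≤ 39b/50`) forces all
increments into `[23b/30, 83b/100]`. Expanding the gap by `b/200` relieves the three compressed nearest
interlayer bonds and costs attraction everywhere else; with the per-site coefficients of part 2 the box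
sums over `[-4,4]²` are certified by `norm_num` (adjacent layers `≥ 2.723`; distances `2, 3, 4, 5`:
`≥ −0.868, −0.119, −0.028, −0.009`), the sites outside the box by the square-shell tail, giving
`(b⁻⁶)·λ_k ≤ Φ_δ(H) − Φ_δ(H + b/200)` on the corresponding height ranges (`vp_low_one, …, vp_low_five`),
and for all farther pairs the crude bound `−(b⁻⁶)(7/400)(b/H)⁵ ≤ Φ_δ(H) − Φ_δ(H + b/200)`, `H ≥ 23b/5`
(`vp_low_far`: `g_β ≤ 3u⁻⁴` and the lattice sum `Σ (P + x²)⁻⁴ ≤ 3.4731 x⁻⁶`). [folklore]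
-/

noncomputable section

namespace Summit.AtomisticToContinuum.Crystallization.Theorems.CleanHull

open scoped BigOperators
open Finset Literature.MathematicalPhysics.StatisticalMechanics

/-! ## The nine box sums -/

/-- Box sum, adjacent layers (offset registry), heights `x ∈ [23/30, 39/50]`. [folklore] -/
theorem vp_box_low_one :
    2723 / 1000 ≤ ∑ p ∈ Icc (-((4 : ℕ) : ℤ)) (4 : ℕ) ×ˢ Icc (-((4 : ℕ) : ℤ)) (4 : ℕ),
      vpCe (53 / 50) (vpP 1 p) (23 / 30) (39 / 50) (1 / 200) := by
  rw [LayeredHull.cvx_sum_box_eq_sum_range]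
  simp only [Finset.sum_range_succ, Finset.sum_range_zero, vpCe, vpM, vpP, vpG]
  push_cast
  norm_num [min_def]

/-- Box sum, distance two, aligned, heights `x ∈ [23/15, 161/100]`. [folklore] -/
theorem vp_box_low_two_aligned :
    -(868 / 1000) ≤ ∑ p ∈ Icc (-((4 : ℕ) : ℤ)) (4 : ℕ) ×ˢ Icc (-((4 : ℕ) : ℤ)) (4 : ℕ),
      vpCe (53 / 50) (vpP 0 p) (23 / 15) (161 / 100) (1 / 200) := by
  rw [LayeredHull.cvx_sum_box_eq_sum_range]
  simp only [Finset.sum_range_succ, Finset.sum_range_zero, vpCe, vpM, vpP, vpG]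
  push_cast
  norm_num [min_def]

/-- Box sum, distance two, offset, heights `x ∈ [23/15, 161/100]`. [folklore] -/
theorem vp_box_low_two_offset :
    -(868 / 1000) ≤ ∑ p ∈ Icc (-((4 : ℕ) : ℤ)) (4 : ℕ) ×ˢ Icc (-((4 : ℕ) : ℤ)) (4 : ℕ),
      vpCe (53 / 50) (vpP 1 p) (23 / 15) (161 / 100) (1 / 200) := by
  rw [LayeredHull.cvx_sum_box_eq_sum_range]
  simp only [Finset.sum_range_succ, Finset.sum_range_zero, vpCe, vpM, vpP, vpG]
  push_cast
  norm_num [min_def]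

/-- Box sum, distance three, aligned, heights `x ∈ [23/10, 61/25]`. [folklore] -/
theorem vp_box_low_three_aligned :
    -(119 / 1000) ≤ ∑ p ∈ Icc (-((4 : ℕ) : ℤ)) (4 : ℕ) ×ˢ Icc (-((4 : ℕ) : ℤ)) (4 : ℕ),
      vpCe (53 / 50) (vpP 0 p) (23 / 10) (61 / 25) (1 / 200) := by
  rw [LayeredHull.cvx_sum_box_eq_sum_range]
  simp only [Finset.sum_range_succ, Finset.sum_range_zero, vpCe, vpM, vpP, vpG]
  push_cast
  norm_num [min_def]

/-- Box sum, distance three, offset, heights `x ∈ [23/10, 61/25]`. [folklore] -/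
theorem vp_box_low_three_offset :
    -(119 / 1000) ≤ ∑ p ∈ Icc (-((4 : ℕ) : ℤ)) (4 : ℕ) ×ˢ Icc (-((4 : ℕ) : ℤ)) (4 : ℕ),
      vpCe (53 / 50) (vpP 1 p) (23 / 10) (61 / 25) (1 / 200) := by
  rw [LayeredHull.cvx_sum_box_eq_sum_range]
  simp only [Finset.sum_range_succ, Finset.sum_range_zero, vpCe, vpM, vpP, vpG]
  push_cast
  norm_num [min_def]

/-- Box sum, distance four, aligned, heights `x ∈ [46/15, 327/100]`. [folklore] -/
theorem vp_box_low_four_aligned :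
    -(28 / 1000) ≤ ∑ p ∈ Icc (-((4 : ℕ) : ℤ)) (4 : ℕ) ×ˢ Icc (-((4 : ℕ) : ℤ)) (4 : ℕ),
      vpCe (53 / 50) (vpP 0 p) (46 / 15) (327 / 100) (1 / 200) := by
  rw [LayeredHull.cvx_sum_box_eq_sum_range]
  simp only [Finset.sum_range_succ, Finset.sum_range_zero, vpCe, vpM, vpP, vpG]
  push_cast
  norm_num [min_def]

/-- Box sum, distance four, offset, heights `x ∈ [46/15, 327/100]`. [folklore] -/
theorem vp_box_low_four_offset :
    -(28 / 1000) ≤ ∑ p ∈ Icc (-((4 : ℕ) : ℤ)) (4 : ℕ) ×ˢ Icc (-((4 : ℕ) : ℤ)) (4 : ℕ),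
      vpCe (53 / 50) (vpP 1 p) (46 / 15) (327 / 100) (1 / 200) := by
  rw [LayeredHull.cvx_sum_box_eq_sum_range]
  simp only [Finset.sum_range_succ, Finset.sum_range_zero, vpCe, vpM, vpP, vpG]
  push_cast
  norm_num [min_def]

/-- Box sum, distance five, aligned, heights `x ∈ [23/6, 41/10]`. [folklore] -/
theorem vp_box_low_five_aligned :
    -(9 / 1000) ≤ ∑ p ∈ Icc (-((4 : ℕ) : ℤ)) (4 : ℕ) ×ˢ Icc (-((4 : ℕ) : ℤ)) (4 : ℕ),
      vpCe (53 / 50) (vpP 0 p) (23 / 6) (41 / 10) (1 / 200) := by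
  rw [LayeredHull.cvx_sum_box_eq_sum_range]
  simp only [Finset.sum_range_succ, Finset.sum_range_zero, vpCe, vpM, vpP, vpG]
  push_cast
  norm_num [min_def]

/-- Box sum, distance five, offset, heights `x ∈ [23/6, 41/10]`. [folklore] -/
theorem vp_box_low_five_offset :
    -(9 / 1000) ≤ ∑ p ∈ Icc (-((4 : ℕ) : ℤ)) (4 : ℕ) ×ˢ Icc (-((4 : ℕ) : ℤ)) (4 : ℕ),
      vpCe (53 / 50) (vpP 1 p) (23 / 6) (41 / 10) (1 / 200) := by
  rw [LayeredHull.cvx_sum_box_eq_sum_range]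
  simp only [Finset.sum_range_succ, Finset.sum_range_zero, vpCe, vpM, vpP, vpG]
  push_cast
  norm_num [min_def]

/-! ## From box sums to layer sums -/

/-- `b ≤ 99/100` gives `53/50 ≤ b⁻⁶`. [folklore] -/
theorem vp_le_beta (b : ℝ) (hb0 : 0 < b) (hb1 : b ≤ 99 / 100) : 53 / 50 ≤ (b⁻¹) ^ 6 := by
  have h1 : 100 / 99 ≤ b⁻¹ := by rw [le_inv_comm₀ (by norm_num) hb0]; linarith
  calc (53 / 50 : ℝ) ≤ (100 / 99) ^ 6 := by norm_num
    _ ≤ (b⁻¹) ^ 6 := pow_le_pow_left₀ (by norm_num) h1 6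

/-- **Expanding with a certified box sum and tail.** If the box sum of `vpCe (53/50) (P_δ ·) x₁ x₂ (1/200)`
is `≥ S` and the shell tail coefficient is `≤ E` then for `b ∈ [47/50, 99/100]` and `H ∈ [x₁ b, x₂ b]`:
`b⁻⁶ · (S − E)/1200 ≤ Φ_δ(H) − Φ_δ(H + b/200)`. [folklore] -/
theorem vp_expand_of_box (δ : ℤ) (hδ : δ = 0 ∨ δ = 1) (x₁ x₂ S E : ℝ) (hx₁ : 0 < x₁)
    (hS : S ≤ ∑ p ∈ Icc (-((4 : ℕ) : ℤ)) (4 : ℕ) ×ˢ Icc (-((4 : ℕ) : ℤ)) (4 : ℕ),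
      vpCe (53 / 50) (vpP δ p) x₁ x₂ (1 / 200))
    (hE : (2 * x₂ + 1 / 200) * (3 * (32 * (((4 : ℕ) : ℝ) + 1) / (3 * (6 * ((4 : ℕ) : ℝ) + 1)) * 1 *
        ((3 / 4 * ((((4 : ℕ) : ℝ)) - 1 / 3) ^ 2 + x₁ ^ 2)⁻¹) ^ 3)) ≤ E)
    (b : ℝ) (hb : 47 / 50 ≤ b) (hb1 : b ≤ 99 / 100) (H : ℝ) (h1 : x₁ * b ≤ H) (h2 : H ≤ x₂ * b) :
    (b⁻¹) ^ 6 * ((S - E) / 1200) ≤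
      layerInteraction lennardJones b H δ 1 - layerInteraction lennardJones b (H + b / 200) δ 1 := by
  have hb0 : 0 < b := by linarith
  set x := H / b with hx
  have hH : H = x * b := by rw [hx]; field_simp
  have hH' : H + b / 200 = (x + 1 / 200) * b := by rw [hx]; field_simp
  have hx1 : x₁ ≤ x := by rw [hx, le_div_iff₀ hb0]; exact h1
  have hx2 : x ≤ x₂ := by rw [hx, div_le_iff₀ hb0]; exact h2
  rw [hH', hH]
  have key := vp_layer_expand b (53 / 50) x₁ x₂ (1 / 200) x δ hδ hb (by norm_num)
    (vp_le_beta b hb0 hb1) (by norm_num) hx₁ hx1 hx2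
  refine le_trans ?_ key
  rw [show (b⁻¹) ^ 6 * ((S - E) / 1200) = (b⁻¹) ^ 6 / 6 * (1 / 200 * S - 1 / 200 * E) by ring]
  refine mul_le_mul_of_nonneg_left ?_ (by positivity)
  have hE' := mul_le_mul_of_nonneg_left hE (show (0 : ℝ) ≤ 1 / 200 by norm_num)
  have hS' := mul_le_mul_of_nonneg_left hS (show (0 : ℝ) ≤ 1 / 200 by norm_num)
  have e : 1 / 200 * (2 * x₂ + 1 / 200) * (3 * (32 * (((4 : ℕ) : ℝ) + 1) / (3 * (6 * ((4 : ℕ) : ℝ) + 1)) * 1 *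
        ((3 / 4 * ((((4 : ℕ) : ℝ)) - 1 / 3) ^ 2 + x₁ ^ 2)⁻¹) ^ 3)) =
      1 / 200 * ((2 * x₂ + 1 / 200) * (3 * (32 * (((4 : ℕ) : ℝ) + 1) / (3 * (6 * ((4 : ℕ) : ℝ) + 1)) * 1 *
        ((3 / 4 * ((((4 : ℕ) : ℝ)) - 1 / 3) ^ 2 + x₁ ^ 2)⁻¹) ^ 3))) := by ring
  rw [e]
  linarith

/-- **Adjacent layers across a LOW gap** (offset registry, `H ∈ [23b/30, 39b/50]`):
`b⁻⁶ · (2.723 − 0.0083)/1200 ≤ Φ_δ(H) − Φ_δ(H + b/200)` (`b ∈ [47/50, 99/100]`). [folklore] -/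
theorem vp_low_one (b : ℝ) (hb : 47 / 50 ≤ b) (hb1 : b ≤ 99 / 100) (δ : ℤ) (hδ : δ % 3 ≠ 0)
    (H : ℝ) (h1 : 23 / 30 * b ≤ H) (h2 : H ≤ 39 / 50 * b) :
    (b⁻¹) ^ 6 * ((2723 / 1000 - 83 / 10000) / 1200) ≤
      layerInteraction lennardJones b H δ 1 - layerInteraction lennardJones b (H + b / 200) δ 1 := by
  rw [layerInteraction_eq_ite lennardJones b H δ, layerInteraction_eq_ite lennardJones b (H + b / 200) δ,
    if_neg hδ, if_neg hδ]
  exact vp_expand_of_box 1 (Or.inr rfl) (23 / 30) (39 / 50) _ _ (by norm_num) vp_box_low_one (by norm_num)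
    b hb hb1 H h1 h2

/-- **Layers at distance two across a LOW gap** (any registry, `H ∈ [23b/15, 161b/100]`):
`b⁻⁶ · (−0.868 − 0.0108)/1200 ≤ Φ_δ(H) − Φ_δ(H + b/200)`. [folklore] -/
theorem vp_low_two (b : ℝ) (hb : 47 / 50 ≤ b) (hb1 : b ≤ 99 / 100) (δ : ℤ)
    (H : ℝ) (h1 : 23 / 15 * b ≤ H) (h2 : H ≤ 161 / 100 * b) :
    (b⁻¹) ^ 6 * ((-(868 / 1000) - 108 / 10000) / 1200) ≤
      layerInteraction lennardJones b H δ 1 - layerInteraction lennardJones b (H + b / 200) δ 1 := by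
  rw [layerInteraction_eq_ite lennardJones b H δ, layerInteraction_eq_ite lennardJones b (H + b / 200) δ]
  split_ifs
  · exact vp_expand_of_box 0 (Or.inl rfl) (23 / 15) (161 / 100) _ _ (by norm_num) vp_box_low_two_aligned
      (by norm_num) b hb hb1 H h1 h2
  · exact vp_expand_of_box 1 (Or.inr rfl) (23 / 15) (161 / 100) _ _ (by norm_num) vp_box_low_two_offset
      (by norm_num) b hb hb1 H h1 h2

/-- **Layers at distance three across a LOW gap** (any registry, `H ∈ [23b/10, 61b/25]`):
`b⁻⁶ · (−0.119 − 0.0087)/1200 ≤ Φ_δ(H) − Φ_δ(H + b/200)`. [folklore] -/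
theorem vp_low_three (b : ℝ) (hb : 47 / 50 ≤ b) (hb1 : b ≤ 99 / 100) (δ : ℤ)
    (H : ℝ) (h1 : 23 / 10 * b ≤ H) (h2 : H ≤ 61 / 25 * b) :
    (b⁻¹) ^ 6 * ((-(119 / 1000) - 87 / 10000) / 1200) ≤
      layerInteraction lennardJones b H δ 1 - layerInteraction lennardJones b (H + b / 200) δ 1 := by
  rw [layerInteraction_eq_ite lennardJones b H δ, layerInteraction_eq_ite lennardJones b (H + b / 200) δ]
  split_ifs
  · exact vp_expand_of_box 0 (Or.inl rfl) (23 / 10) (61 / 25) _ _ (by norm_num) vp_box_low_three_aligned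
      (by norm_num) b hb hb1 H h1 h2
  · exact vp_expand_of_box 1 (Or.inr rfl) (23 / 10) (61 / 25) _ _ (by norm_num) vp_box_low_three_offset
      (by norm_num) b hb hb1 H h1 h2

/-- **Layers at distance four across a LOW gap** (any registry, `H ∈ [46b/15, 327b/100]`):
`b⁻⁶ · (−0.028 − 0.0057)/1200 ≤ Φ_δ(H) − Φ_δ(H + b/200)`. [folklore] -/
theorem vp_low_four (b : ℝ) (hb : 47 / 50 ≤ b) (hb1 : b ≤ 99 / 100) (δ : ℤ)
    (H : ℝ) (h1 : 46 / 15 * b ≤ H) (h2 : H ≤ 327 / 100 * b) :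
    (b⁻¹) ^ 6 * ((-(28 / 1000) - 57 / 10000) / 1200) ≤
      layerInteraction lennardJones b H δ 1 - layerInteraction lennardJones b (H + b / 200) δ 1 := by
  rw [layerInteraction_eq_ite lennardJones b H δ, layerInteraction_eq_ite lennardJones b (H + b / 200) δ]
  split_ifs
  · exact vp_expand_of_box 0 (Or.inl rfl) (46 / 15) (327 / 100) _ _ (by norm_num) vp_box_low_four_aligned
      (by norm_num) b hb hb1 H h1 h2
  · exact vp_expand_of_box 1 (Or.inr rfl) (46 / 15) (327 / 100) _ _ (by norm_num) vp_box_low_four_offset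
      (by norm_num) b hb hb1 H h1 h2

/-- **Layers at distance five across a LOW gap** (any registry, `H ∈ [23b/6, 41b/10]`):
`b⁻⁶ · (−0.009 − 0.0035)/1200 ≤ Φ_δ(H) − Φ_δ(H + b/200)`. [folklore] -/
theorem vp_low_five (b : ℝ) (hb : 47 / 50 ≤ b) (hb1 : b ≤ 99 / 100) (δ : ℤ)
    (H : ℝ) (h1 : 23 / 6 * b ≤ H) (h2 : H ≤ 41 / 10 * b) :
    (b⁻¹) ^ 6 * ((-(9 / 1000) - 35 / 10000) / 1200) ≤
      layerInteraction lennardJones b H δ 1 - layerInteraction lennardJones b (H + b / 200) δ 1 := by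
  rw [layerInteraction_eq_ite lennardJones b H δ, layerInteraction_eq_ite lennardJones b (H + b / 200) δ]
  split_ifs
  · exact vp_expand_of_box 0 (Or.inl rfl) (23 / 6) (41 / 10) _ _ (by norm_num) vp_box_low_five_aligned
      (by norm_num) b hb hb1 H h1 h2
  · exact vp_expand_of_box 1 (Or.inr rfl) (23 / 6) (41 / 10) _ _ (by norm_num) vp_box_low_five_offset
      (by norm_num) b hb hb1 H h1 h2

/-! ## The far pairs -/

/-- The lattice sum `Σ_p (P_δ(p) + x²)⁻⁴ ≤ 3.4731 · x⁻⁶` for `x ≥ 23/5` (`δ ∈ {0,1}`): box `[-1,1]²` and the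
square-shell tail of `LayeredHull.cvx_lattice_tsum_le`. [folklore] -/
theorem vp_lattice_far (δ : ℤ) (hδ : δ = 0 ∨ δ = 1) (x : ℝ) (hx : 23 / 5 ≤ x) :
    (Summable fun p : ℤ × ℤ => ((vpP δ p + x ^ 2)⁻¹) ^ 4) ∧
      ∑' p : ℤ × ℤ, ((vpP δ p + x ^ 2)⁻¹) ^ 4 ≤ 34731 / 10000 * (x⁻¹) ^ 6 := by
  have hx0 : 0 < x := by linarith
  have hT : 0 < x ^ 2 := by positivity
  obtain ⟨hs, hle⟩ := LayeredHull.cvx_lattice_tsum_le (F := fun p : ℤ × ℤ => ((vpP δ p + x ^ 2)⁻¹) ^ 4)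
    (fun p => by have := vpP_nonneg δ p; positivity) (N := 1) (n := 3) le_rfl (by norm_num) zero_le_one hT
    (by
      intro p hp
      have hshell := LayeredHull.cvx_P_ge_shell δ hδ p (by omega)
      rw [one_mul]
      refine pow_le_pow_left₀ (by have := vpP_nonneg δ p; positivity) (inv_anti₀ (by positivity) ?_) 4
      unfold vpP; linarith)
  refine ⟨hs, hle.trans ?_⟩
  -- the box: nine sites, each at most `(x²)⁻⁴`
  have hbox : ∑ p ∈ Icc (-((1 : ℕ) : ℤ)) (1 : ℕ) ×ˢ Icc (-((1 : ℕ) : ℤ)) (1 : ℕ),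
      ((vpP δ p + x ^ 2)⁻¹) ^ 4 ≤ 9 * ((x ^ 2)⁻¹) ^ 4 := by
    have hcard := LayeredHull.cvx_card_box 1
    have h := Finset.sum_le_card_nsmul (Icc (-((1 : ℕ) : ℤ)) (1 : ℕ) ×ˢ Icc (-((1 : ℕ) : ℤ)) (1 : ℕ))
      (fun p : ℤ × ℤ => ((vpP δ p + x ^ 2)⁻¹) ^ 4) (((x ^ 2)⁻¹) ^ 4) (fun p _ => by
        have := vpP_nonneg δ p
        exact pow_le_pow_left₀ (by positivity) (inv_anti₀ hT (by linarith)) 4)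
    rw [hcard] at h
    refine h.trans (le_of_eq ?_)
    norm_num
  -- the tail
  have htail : ((3 / 4 * (((1 : ℕ) : ℝ) - 1 / 3) ^ 2 + x ^ 2)⁻¹) ^ 3 ≤ ((x ^ 2)⁻¹) ^ 3 := by
    refine pow_le_pow_left₀ (by positivity) (inv_anti₀ hT ?_) 3
    push_cast; nlinarith
  -- `(x²)⁻¹ = y²`, `y = x⁻¹ ≤ 5/23`
  have hy : x⁻¹ ≤ 5 / 23 := by rw [inv_le_comm₀ hx0 (by norm_num)]; linarith
  have hy0 : 0 ≤ x⁻¹ := by positivity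
  have e2 : (x ^ 2)⁻¹ = (x⁻¹) ^ 2 := by rw [inv_pow]
  rw [e2] at hbox htail
  have hy2 : (x⁻¹) ^ 2 ≤ (5 / 23) ^ 2 := pow_le_pow_left₀ hy0 hy 2
  have hy6 : 0 ≤ (x⁻¹) ^ 6 := by positivity
  have hcoef : (0 : ℝ) ≤ 32 * (((1 : ℕ) : ℝ) + 1) / (3 * (6 * ((1 : ℕ) : ℝ) + 1)) * 1 := by positivity
  have htail' := mul_le_mul_of_nonneg_left htail hcoef
  calc _ ≤ 9 * ((x⁻¹) ^ 2) ^ 4 + 32 * (((1 : ℕ) : ℝ) + 1) / (3 * (6 * ((1 : ℕ) : ℝ) + 1)) * 1 *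
        ((x⁻¹) ^ 2) ^ 3 := add_le_add hbox htail'
    _ = (x⁻¹) ^ 6 * (9 * (x⁻¹) ^ 2 + 64 / 21) := by push_cast; ring
    _ ≤ (x⁻¹) ^ 6 * (9 * (5 / 23) ^ 2 + 64 / 21) := by
        apply mul_le_mul_of_nonneg_left _ hy6; linarith
    _ ≤ 34731 / 10000 * (x⁻¹) ^ 6 := by
        rw [mul_comm]; apply mul_le_mul_of_nonneg_right _ hy6; norm_num

/-- **The far pairs.** For `b ≥ 47/50`, any registry and `H ≥ 23b/5`:
`−b⁻⁶ · (7/400) · (b/H)⁵ ≤ Φ_δ(H) − Φ_δ(H + b/200)` (per site `g_β ≤ 3u⁻⁴`, then `vp_lattice_far`).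
[folklore] -/
theorem vp_low_far (b : ℝ) (hb : 47 / 50 ≤ b) (δ : ℤ) (H : ℝ) (hH : 23 / 5 * b ≤ H) :
    -((b⁻¹) ^ 6 * (7 / 400) * (b / H) ^ 5) ≤
      layerInteraction lennardJones b H δ 1 - layerInteraction lennardJones b (H + b / 200) δ 1 := by
  have hb0 : 0 < b := by linarith
  set x := H / b with hx
  have hH1 : H = x * b := by rw [hx]; field_simp
  have hH' : H + b / 200 = (x + 1 / 200) * b := by rw [hx]; field_simp
  have hx1 : 23 / 5 ≤ x := by rw [hx, le_div_iff₀ hb0]; linarith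
  have hx0 : 0 < x := by linarith
  have hHx : b / H = x⁻¹ := by rw [hx, inv_div]
  have key : ∀ δ' : ℤ, (δ' = 0 ∨ δ' = 1) → -((b⁻¹) ^ 6 * (7 / 400) * (x⁻¹) ^ 5) ≤
      layerInteraction lennardJones b (x * b) δ' 1 - layerInteraction lennardJones b ((x + 1 / 200) * b) δ' 1 := by
    intro δ' hδ'
    have hs1 := vp_summable b hb δ' hδ' (x * b) (by positivity)
    have hs2 := vp_summable b hb δ' hδ' ((x + 1 / 200) * b) (by positivity)
    obtain ⟨hGs, hGle⟩ := vp_lattice_far δ' hδ' x hx1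
    set c : ℝ := (b⁻¹) ^ 6 / 6 * (1 / 200 * (2 * x + 1 / 200) * 3) with hc
    have hc0 : 0 ≤ c := by positivity
    rw [vp_layerInteraction_eq, vp_layerInteraction_eq, ← hs1.tsum_sub hs2]
    have hpt : ∀ p : ℤ × ℤ, -(c * ((vpP δ' p + x ^ 2)⁻¹) ^ 4) ≤
        vpTerm b (vpP δ' p) (x * b) - vpTerm b (vpP δ' p) ((x + 1 / 200) * b) := by
      intro p
      have := vp_site_expand_crude b (vpP δ' p) x x (1 / 200) x hb0 (vpP_nonneg δ' p) (by norm_num) hx0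
        le_rfl le_rfl
      refine le_trans (le_of_eq ?_) this
      rw [hc]; ring
    have hlow := ((hGs.mul_left c).neg).tsum_le_tsum hpt (hs1.sub hs2)
    refine le_trans ?_ hlow
    rw [tsum_neg, tsum_mul_left, neg_le_neg_iff]
    refine (mul_le_mul_of_nonneg_left hGle hc0).trans ?_
    -- `c · 3.4731 x⁻⁶ ≤ b⁻⁶ (7/400) x⁻⁵`
    rw [hc]
    have hy : x⁻¹ ≤ 5 / 23 := by rw [inv_le_comm₀ hx0 (by norm_num)]; linarith
    have hy0 : 0 ≤ x⁻¹ := by positivity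
    have hxy : x * x⁻¹ = 1 := mul_inv_cancel₀ hx0.ne'
    have hb6 : 0 ≤ (b⁻¹) ^ 6 := by positivity
    have e : (b⁻¹) ^ 6 / 6 * (1 / 200 * (2 * x + 1 / 200) * 3) * (34731 / 10000 * (x⁻¹) ^ 6) =
        (b⁻¹) ^ 6 * ((x⁻¹) ^ 5 * ((2 * (x * x⁻¹) + 1 / 200 * x⁻¹) * (34731 / 4000000))) := by ring
    rw [e, hxy, show (b⁻¹) ^ 6 * (7 / 400) * (x⁻¹) ^ 5 = (b⁻¹) ^ 6 * ((x⁻¹) ^ 5 * (7 / 400)) by ring]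
    refine mul_le_mul_of_nonneg_left ?_ hb6
    refine mul_le_mul_of_nonneg_left ?_ (by positivity)
    nlinarith
  rw [hH', hHx, hH1, layerInteraction_eq_ite lennardJones b (x * b) δ,
    layerInteraction_eq_ite lennardJones b ((x + 1 / 200) * b) δ]
  split_ifs
  · exact key 0 (Or.inl rfl)
  · exact key 1 (Or.inr rfl)

end Summit.AtomisticToContinuum.Crystallization.Theorems.CleanHull

end
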